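import Mathlib
import Summits.Ventures.PercRepro.TriangleCapEqualityLemmas
import Summits.Ventures.PercRepro.TriangleCapDenseEquality

/-!
# PercRepro — THE EQUALITY LOCUS OF THE CLOSED FORM: the extremal `K₄⁻`-free graphs of the cherry table are
the complete bipartite graphs `K_{a, k−a}` minus a star (p3, gen 41; part 168)

On the cell `m = a (k − a) − r` with `3 ≤ a`, `2a + r ≤ k` and `k ≥ r + 7`, a `K₄⁻`-free graph `D` on `k`
vertices attains the closed form `Σ_v d(v)² = m k − r (k − 1 − r)` (equivalently `2·Σ_v C(d(v), 2) =
m (k − 2) − r (k − 1 − r)`, the maximum of part 162) **iff** there are a vertex set `A` with `|A| = a` and a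
vertex `v` such that every edge of `D` crosses `A` and every cross pair of `A`, `Aᶜ` missing from `D` contains `v`:
`D` is `K_{a, k−a}` minus a star of `r` edges at one vertex (`closed_form_eq_iff`, `closed_form_equality_locus`).
The proof is a strong induction on `r` through the equality cases of the degree argument (part 167): at `r = 0`
the diagonal's locus (part 132: complete bipartite spanning, `k ≥ 7`) with `|A| ∈ {a, k − a}`; at `r ≥ 1` an
extremal graph has a vertex `z` of degree `< a`, its deletion is within the row and tight, so `z` has degree `a − 1`
or `a − r`, its neighbours sit at the cap `k − a`, `D − z` is extremal on the cell `r + d − a ≤ r − 1` at `k − 1`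
(hence `≤ K(A', A'ᶜ)` with `|A'| = a` by induction), and the transport lifts the bipartition to `D` (when
`k − 1 = 2a` the cell forces `r = 1` and `k ≥ 8` gives `a ≥ 4`, so `z` has `≥ 3` neighbours and `K₄⁻`-freeness
keeps them on one side). The bound `k ≥ r + 7` is sharp: at `(k, a, r) = (7, 3, 1)` the graph `K_{3,3}` plus a
vertex joined to the two ends of an edge is extremal and not bipartite, and at `k − r = 6` the prism-hanging family
of §10as(d) appears. Given the bipartition, the star shape of the missing pairs is the equality clause of the
bipartite sub-problem (part 165). Axioms: standard.
-/

namespace PercRepro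

namespace TriangleCap

namespace C047

open Finset

universe u

variable {V : Type*} [Fintype V] [DecidableEq V]

/-- The cell in the two coordinates: `m + a² + r = a k`, `a ≤ k` ⇒ `m + r = a (k − a)`. -/
theorem cell_edges (a r k m : ℕ) (hm : m + a * a + r = a * k) (hak : a ≤ k) : m + r = a * (k - a) := by
  obtain ⟨c, rfl⟩ : ∃ c, k = a + c := ⟨k - a, by omega⟩
  rw [Nat.add_sub_cancel_left]
  nlinarith [hm]

omit [Fintype V] [DecidableEq V] in
/-- A complete bipartite spanning graph is a spanning subgraph of `K(A, Aᶜ)`. -/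
theorem bipSub_of_xor (D : SimpleGraph V) (A : Finset V) (hA : ∀ x y, D.Adj x y ↔ Xor (x ∈ A) (y ∈ A)) :
    BipSub D A := by
  intro x y h
  rw [hA] at h
  rcases h with ⟨h1, h2⟩ | ⟨h1, h2⟩
  · exact ⟨fun _ => h2, fun _ => h1⟩
  · exact ⟨fun h => absurd h h2, fun h => absurd h1 h⟩

/-- `x (k − x) = a (k − a)` with `x, a ≤ k` ⇒ `x = a` or `x = k − a`. -/
theorem eq_or_eq_of_mul_sub_eq (x a k : ℕ) (hx : x ≤ k) (ha : a ≤ k) (h : x * (k - x) = a * (k - a)) :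
    x = a ∨ x + a = k := by
  obtain ⟨c, rfl⟩ : ∃ c, k = x + c := ⟨k - x, by omega⟩
  obtain ⟨e, he⟩ : ∃ e, x + c = a + e := ⟨x + c - a, by omega⟩
  rw [Nat.add_sub_cancel_left, he, Nat.add_sub_cancel_left] at h
  -- `x c = a e` with `x + c = a + e`: `(x − a)(x − e) = 0` over `ℤ`
  have hz : ((x : ℤ) - a) * ((x : ℤ) - e) = 0 := by
    have h1 : (x : ℤ) * c = a * e := by exact_mod_cast h
    have h2 : (x : ℤ) + c = a + e := by exact_mod_cast he
    nlinarith [h1, h2]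
  rcases mul_eq_zero.mp hz with h0 | h0
  · left; omega
  · right; omega

/-- **THE EQUALITY LOCUS BY STRONG INDUCTION ON `r`, EVERY VERTEX TYPE:** on `n` vertices, `K₄⁻`-free, `3 ≤ a`,
`2a + r ≤ n`, `r + 7 ≤ n`, `m + a² + r = a n`, `Σ_v d(v)² + r (n − 1 − r) = m n` ⇒ `D` is a spanning subgraph
of `K(A, Aᶜ)` for some `A` with `|A| = a`. -/
theorem equality_locus_aux (r : ℕ) :
    ∀ (W : Type u) [Fintype W] [DecidableEq W] (D : SimpleGraph W) [DecidableRel D.Adj], K4mFree D →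
      ∀ a, 3 ≤ a → 2 * a + r ≤ Fintype.card W → r + 7 ≤ Fintype.card W →
      D.edgeFinset.card + a * a + r = a * Fintype.card W →
      ∑ v, deg D v * deg D v + r * (Fintype.card W - 1 - r) = D.edgeFinset.card * Fintype.card W →
      ∃ A : Finset W, A.card = a ∧ BipSub D A := by
  refine Nat.strong_induction_on r ?_
  intro r ih W _ _ D _ hK a ha hk hk7 hm heq
  rcases Nat.eq_zero_or_pos r with hr0 | hr1
  · -- the diagonal: complete bipartite spanning with `|A| ∈ {a, k − a}`
    subst hr0
    simp only [zero_mul, add_zero] at heq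
    have h2 : 2 * cherries D + 2 * D.edgeFinset.card = D.edgeFinset.card * Fintype.card W := by
      have := two_mul_cherries_add D
      have := sum_deg_eq D
      omega
    obtain ⟨A, hA⟩ := (dense_eq_iff D hK (by omega)).mp h2
    have hsub : BipSub D A := bipSub_of_xor D A hA
    have hcardE := card_edges_eq_of_complete_bipartite D A hA
    have hcell : D.edgeFinset.card = a * (Fintype.card W - a) := by
      have := cell_edges a 0 (Fintype.card W) D.edgeFinset.card (by simpa using hm) (by omega)
      simpa using this
    rcases eq_or_eq_of_mul_sub_eq A.card a (Fintype.card W) (card_le_univ A) (by omega) (by omega) with h | h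
    · exact ⟨A, h, hsub⟩
    · refine ⟨Aᶜ, by rw [card_compl]; omega, bipSub_compl D A hsub⟩
  -- `r ≥ 1`: the max-degree cap
  have hcap : ∀ v, deg D v + a ≤ Fintype.card W := fun v =>
    deg_add_le_card_of_dense D hK a ha (by omega)
      (cap_arith a (Fintype.card W) D.edgeFinset.card r (by omega) hk hm) v
  by_cases hdeg : ∀ z, a ≤ deg D z
  · -- every degree `≥ a`: strictly below the closed form
    exfalso
    have h1 := band_stability_of_min_degree_strict D a r hcap hdeg (by omega) hm
    have h2 : r * (Fintype.card W - 1 - r) < r * Fintype.card W :=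
      Nat.mul_lt_mul_of_pos_left (by omega) hr1
    omega
  push Not at hdeg
  obtain ⟨z, hz⟩ := hdeg
  rcases Nat.lt_or_ge (r + deg D z) a with hcross | hwithin
  · -- across the row: never tight
    exfalso
    have := band_of_low_degree_cross_strict D hK a r hcap (z := z) (by omega) (by omega) (by omega) hm
    omega
  · -- within the row: tight deletion, induction on `D − z`, transport
    have hK' := k4mFree_del D hK z
    have hcard' := card_del z
    have hedges' := card_edges_del D z
    have hak : a * Fintype.card W = a * Fintype.card {v : W // v ≠ z} + a := by
      rw [← hcard']
      ring
    have hm' : (del D z).edgeFinset.card + a * a + (r + deg D z - a) = a * Fintype.card {v : W // v ≠ z} := by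
      omega
    have hrow := closed_form_stability (del D z) hK' a (r + deg D z - a) ha (by omega) hm'
    obtain ⟨hcase, hnb, heq'⟩ :=
      band_of_low_degree_eq D a r hcap (z := z) (by omega) hwithin (by omega) hm hrow heq
    obtain ⟨A', hA', hsub'⟩ := ih (r + deg D z - a) (by omega) {v : W // v ≠ z} (del D z) hK' a ha (by omega)
      (by omega) hm' heq'
    apply bipSub_of_del D hK z a A' hA' hsub' hnb
    omega

/-- **EVERY EXTREMAL GRAPH IS BIPARTITE WITH PARTS `a`, `k − a`:** `K₄⁻`-free, `3 ≤ a`, `2a + r ≤ k`,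
`r + 7 ≤ k`, `m + a² + r = a k`, `Σ_v d(v)² + r (k − 1 − r) = m k` ⇒ `D ≤ K(A, Aᶜ)` for some `A` with `|A| = a`. -/
theorem bipSub_of_closed_form_eq (D : SimpleGraph V) [DecidableRel D.Adj] (hK : K4mFree D) (a r : ℕ)
    (ha : 3 ≤ a) (hk : 2 * a + r ≤ Fintype.card V) (hk7 : r + 7 ≤ Fintype.card V)
    (hm : D.edgeFinset.card + a * a + r = a * Fintype.card V)
    (heq : ∑ v, deg D v * deg D v + r * (Fintype.card V - 1 - r) = D.edgeFinset.card * Fintype.card V) :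
    ∃ A : Finset V, A.card = a ∧ BipSub D A :=
  equality_locus_aux r V D hK a ha hk hk7 hm heq

/-- **THE EQUALITY LOCUS OF THE CLOSED FORM (degree form, every vertex type):** `K₄⁻`-free, `3 ≤ a`,
`2a + r ≤ k`, `r + 7 ≤ k`, `m + a² + r = a k`: `Σ_v d(v)² + r (k − 1 − r) = m k` iff `D` is a spanning subgraph
of some `K(A, Aᶜ)` with `|A| = a` whose missing cross pairs form a star — `K_{a, k−a}` minus `r` edges at one
vertex. -/
theorem closed_form_eq_iff (D : SimpleGraph V) [DecidableRel D.Adj] (hK : K4mFree D) (a r : ℕ) (ha : 3 ≤ a)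
    (hk : 2 * a + r ≤ Fintype.card V) (hk7 : r + 7 ≤ Fintype.card V)
    (hm : D.edgeFinset.card + a * a + r = a * Fintype.card V) :
    ∑ v, deg D v * deg D v + r * (Fintype.card V - 1 - r) = D.edgeFinset.card * Fintype.card V ↔
      ∃ (A : Finset V) (v : V), A.card = a ∧ BipSub D A ∧ MissingStar D A v := by
  have hcell := cell_edges a r (Fintype.card V) D.edgeFinset.card hm (by omega)
  constructor
  · intro heq
    obtain ⟨A, hA, hsub⟩ := bipSub_of_closed_form_eq D hK a r ha hk hk7 hm heq
    obtain ⟨v, hv⟩ := exists_missingStar_of_closed_form_eq D A hsub a r hA hcell (by omega) heq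
    exact ⟨A, v, hA, hsub, hv⟩
  · rintro ⟨A, v, hA, hsub, hv⟩
    exact closed_form_eq_of_missingStar D A hsub hv a r hA hcell (by omega)

/-- **THE EQUALITY LOCUS OF THE CLOSED FORM ON `Fin k` (cherry form):** for `3 ≤ a`, `2a + r ≤ k`, `r + 7 ≤ k`,
a `K₄⁻`-free graph on `Fin k` with `a (k − a) − r` edges attains the maximum `2·Σ_v C(d(v), 2) =
(a (k − a) − r)(k − 2) − r (k − 1 − r)` of the cherry table iff it is `K_{a, k−a}` minus a star of `r` edges at one
vertex: some `A` with `|A| = a` and some `v` with every edge crossing `A` and every missing cross pair through `v`. -/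
theorem closed_form_equality_locus (k a r : ℕ) (ha : 3 ≤ a) (hk : 2 * a + r ≤ k) (hk7 : r + 7 ≤ k)
    (D : SimpleGraph (Fin k)) [DecidableRel D.Adj] (hK : K4mFree D) (hD : D.edgeFinset.card = a * (k - a) - r) :
    2 * cherries D + r * (k - 1 - r) = (a * (k - a) - r) * (k - 2) ↔
      ∃ (A : Finset (Fin k)) (v : Fin k), A.card = a ∧ BipSub D A ∧ MissingStar D A v := by
  have hcard : Fintype.card (Fin k) = k := Fintype.card_fin k
  have hrle : r ≤ a * (k - a) := by
    obtain ⟨c, hc⟩ : ∃ c, k = a + c := ⟨k - a, by omega⟩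
    rw [hc, Nat.add_sub_cancel_left]
    have : c ≤ a * c := Nat.le_mul_of_pos_left c (by omega)
    omega
  have hm : D.edgeFinset.card + a * a + r = a * Fintype.card (Fin k) := by
    rw [hcard, hD]
    obtain ⟨c, hc⟩ : ∃ c, k = a + c := ⟨k - a, by omega⟩
    rw [hc, Nat.add_sub_cancel_left] at hrle ⊢
    obtain ⟨q, hq⟩ : ∃ q, a * c = r + q := ⟨a * c - r, by omega⟩
    rw [hq, Nat.add_sub_cancel_left]
    nlinarith [hq]
  rw [← closed_form_eq_iff D hK a r ha (by rw [hcard]; exact hk) (by rw [hcard]; exact hk7) hm, hcard, ← hD]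
  have h2 := two_mul_cherries_add D
  have h3 := sum_deg_eq D
  have e : D.edgeFinset.card * (k - 2) + 2 * D.edgeFinset.card = D.edgeFinset.card * k := by
    rw [mul_comm 2, ← Nat.mul_add, Nat.sub_add_cancel (by omega : 2 ≤ k)]
  omega

end C047

end TriangleCap

end PercRepro
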